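import Summits.AtomisticToContinuum.HydrodynamicLimit.Theorems.ImplosionDichotomyPolynomialCompressionEosBounds
import Literature.Analysis.FluidPDE.KNSSLocalSmoothingHolds

/-!
# Higher `O(packing)` bounds of the rescaled hard-sphere law: `r³ ζ'''(r)`, `r⁴ ζ''''(r)`

Helper file for the line `log-lipschitz-budget` of the crux `ImplosionDichotomy.PolynomialCompression`
(stmt-AtomisticToContinuum-12587), stub `stub_logBudgetShadowing` (levels 2–3 and the close: the input of
`ShadowEosHigher`). Sequel of `…EosBounds` (`hsEos_rescaled_bounds`, orders `0, 1, 2`): for `F` analytic on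
`(-η₀, η₀)` and the rescaled law `ζ(r) = Zf(rσ³)`, `Zf(η) = 1 + η F'(η)`, one has `ζ⁽ⁿ⁾(r) = σ³ⁿ Zf⁽ⁿ⁾(rσ³)`
(dilation) and `Zf⁽ⁿ⁾ = n F⁽ⁿ⁾ + η F⁽ⁿ⁺¹⁾`, whence `|rⁿ ζ⁽ⁿ⁾(r)| = |ηⁿ Zf⁽ⁿ⁾(η)| ≤ cZ · η` for `η = rσ³ ≤ η₀/2`,
`n = 3, 4`. No hypothesis on `hsExcessFreeEnergy` is needed here (pure calculus on `F`).
-/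

noncomputable section

namespace Summit.AtomisticToContinuum.HydrodynamicLimit.Theorems

open Set Filter Topology MeasureTheory
open scoped ContDiff
open Literature.MathematicalPhysics.KineticTheory Literature.Analysis.FunctionSpaces

/-- Derivatives of `Zf(η) = 1 + η F'(η)` up to order four on the open interval of analyticity:
`Zf' = F' + ηF''`, `Zf'' = 2F'' + ηF'''`, `Zf''' = 3F''' + ηF''''`, `Zf'''' = 4F'''' + ηF⁽⁵⁾`. [folklore] -/
theorem deriv_iter_one_add_mul_deriv : ∀ {η₀ : ℝ} {F : ℝ → ℝ}, ContDiffOn ℝ ∞ F (Ioo (-η₀) η₀) →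
    ∀ η ∈ Ioo (-η₀) η₀,
      deriv (deriv (deriv (fun η => 1 + η * deriv F η))) η =
          3 * deriv (deriv (deriv F)) η + η * deriv (deriv (deriv (deriv F))) η ∧
        deriv (deriv (deriv (deriv (fun η => 1 + η * deriv F η)))) η =
          4 * deriv (deriv (deriv (deriv F))) η + η * deriv (deriv (deriv (deriv (deriv F)))) η := by
  intro η₀ F hF
  -- smoothness of all derivatives of `F` on the open interval
  have hF1 : ContDiffOn ℝ ∞ (deriv F) (Ioo (-η₀) η₀) := hF.deriv_of_isOpen isOpen_Ioo le_rfl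
  have hF2 : ContDiffOn ℝ ∞ (deriv (deriv F)) (Ioo (-η₀) η₀) := hF1.deriv_of_isOpen isOpen_Ioo le_rfl
  have hF3 : ContDiffOn ℝ ∞ (deriv (deriv (deriv F))) (Ioo (-η₀) η₀) :=
    hF2.deriv_of_isOpen isOpen_Ioo le_rfl
  have hF4 : ContDiffOn ℝ ∞ (deriv (deriv (deriv (deriv F)))) (Ioo (-η₀) η₀) :=
    hF3.deriv_of_isOpen isOpen_Ioo le_rfl
  have dAt : ∀ {g : ℝ → ℝ}, ContDiffOn ℝ ∞ g (Ioo (-η₀) η₀) → ∀ s ∈ Ioo (-η₀) η₀,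
      HasDerivAt g (deriv g s) s := fun hg s hs =>
    ((hg.differentiableOn (by simp)).differentiableAt (isOpen_Ioo.mem_nhds hs)).hasDerivAt
  -- order 1: `Zf' = F' + η F''` on the interval
  have h1 : ∀ s ∈ Ioo (-η₀) η₀,
      HasDerivAt (fun η => 1 + η * deriv F η) (deriv F s + s * deriv (deriv F) s) s := by
    intro s hs
    have := ((hasDerivAt_id' s).mul (dAt hF1 s hs)).const_add 1
    exact this.congr_deriv (by ring)
  have e1 : ∀ s ∈ Ioo (-η₀) η₀, deriv (fun η => 1 + η * deriv F η) =ᶠ[𝓝 s]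
      fun η => deriv F η + η * deriv (deriv F) η := fun s hs =>
    (eventually_of_mem (isOpen_Ioo.mem_nhds hs) fun η hη => (h1 η hη).deriv)
  -- order 2: `Zf'' = 2F'' + η F'''`
  have h2 : ∀ s ∈ Ioo (-η₀) η₀,
      HasDerivAt (fun η => deriv F η + η * deriv (deriv F) η)
        (2 * deriv (deriv F) s + s * deriv (deriv (deriv F)) s) s := by
    intro s hs
    have := (dAt hF1 s hs).add ((hasDerivAt_id' s).mul (dAt hF2 s hs))
    exact this.congr_deriv (by ring)
  have d2 : ∀ s ∈ Ioo (-η₀) η₀, deriv (deriv (fun η => 1 + η * deriv F η)) s =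
      2 * deriv (deriv F) s + s * deriv (deriv (deriv F)) s := fun s hs => by
    rw [(e1 s hs).deriv_eq]; exact (h2 s hs).deriv
  have e2 : ∀ s ∈ Ioo (-η₀) η₀, deriv (deriv (fun η => 1 + η * deriv F η)) =ᶠ[𝓝 s]
      fun η => 2 * deriv (deriv F) η + η * deriv (deriv (deriv F)) η := fun s hs =>
    eventually_of_mem (isOpen_Ioo.mem_nhds hs) fun η hη => d2 η hη
  -- order 3
  have h3 : ∀ s ∈ Ioo (-η₀) η₀,
      HasDerivAt (fun η => 2 * deriv (deriv F) η + η * deriv (deriv (deriv F)) η)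
        (3 * deriv (deriv (deriv F)) s + s * deriv (deriv (deriv (deriv F))) s) s := by
    intro s hs
    have := ((dAt hF2 s hs).const_mul 2).add ((hasDerivAt_id' s).mul (dAt hF3 s hs))
    exact this.congr_deriv (by ring)
  have d3 : ∀ s ∈ Ioo (-η₀) η₀, deriv (deriv (deriv (fun η => 1 + η * deriv F η))) s =
      3 * deriv (deriv (deriv F)) s + s * deriv (deriv (deriv (deriv F))) s := fun s hs => by
    rw [(e2 s hs).deriv_eq]; exact (h3 s hs).deriv
  have e3 : ∀ s ∈ Ioo (-η₀) η₀, deriv (deriv (deriv (fun η => 1 + η * deriv F η))) =ᶠ[𝓝 s]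
      fun η => 3 * deriv (deriv (deriv F)) η + η * deriv (deriv (deriv (deriv F))) η := fun s hs =>
    eventually_of_mem (isOpen_Ioo.mem_nhds hs) fun η hη => d3 η hη
  -- order 4
  have h4 : ∀ s ∈ Ioo (-η₀) η₀,
      HasDerivAt (fun η => 3 * deriv (deriv (deriv F)) η + η * deriv (deriv (deriv (deriv F))) η)
        (4 * deriv (deriv (deriv (deriv F))) s + s * deriv (deriv (deriv (deriv (deriv F)))) s) s := by
    intro s hs
    have := ((dAt hF3 s hs).const_mul 3).add ((hasDerivAt_id' s).mul (dAt hF4 s hs))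
    exact this.congr_deriv (by ring)
  have d4 : ∀ s ∈ Ioo (-η₀) η₀, deriv (deriv (deriv (deriv (fun η => 1 + η * deriv F η)))) s =
      4 * deriv (deriv (deriv (deriv F))) s + s * deriv (deriv (deriv (deriv (deriv F)))) s :=
    fun s hs => by rw [(e3 s hs).deriv_eq]; exact (h4 s hs).deriv
  exact fun η hη => ⟨d3 η hη, d4 η hη⟩

/-- **Higher `O(packing)` bounds of the rescaled law.** For `F` analytic on `(-η₀, η₀)` there are
`η₃ ∈ (0, η₀)` and `cZ ≥ 0` such that for every `σ > 0` and `0 ≤ r` with `rσ³ ≤ η₃`: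
`|r³ ζ'''(r)|, |r⁴ ζ''''(r)| ≤ cZ · rσ³`, `ζ(r) = 1 + rσ³ F'(rσ³)`. [folklore] -/
theorem hsEos_rescaled_bounds_higher :
    ∀ η₀ : ℝ, 0 < η₀ → ∀ F : ℝ → ℝ, AnalyticOnNhd ℝ F (Ioo (-η₀) η₀) →
      ∃ η₃ cZ : ℝ, 0 < η₃ ∧ η₃ < η₀ ∧ 0 ≤ cZ ∧ ∀ σ : ℝ, 0 < σ → ∀ r : ℝ, 0 ≤ r → r * σ ^ 3 ≤ η₃ →
        |r ^ 3 * deriv (deriv (deriv (fun r => 1 + r * σ ^ 3 * deriv F (r * σ ^ 3)))) r| ≤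
            cZ * (r * σ ^ 3) ∧
        |r ^ 4 * deriv (deriv (deriv (deriv (fun r => 1 + r * σ ^ 3 * deriv F (r * σ ^ 3))))) r| ≤
            cZ * (r * σ ^ 3) := by
  intro η₀ hη₀ F hF
  have hFc : ContDiffOn ℝ ∞ F (Ioo (-η₀) η₀) := hF.contDiffOn_of_completeSpace
  have hF1 : ContDiffOn ℝ ∞ (deriv F) (Ioo (-η₀) η₀) := hFc.deriv_of_isOpen isOpen_Ioo le_rfl
  have hF2 : ContDiffOn ℝ ∞ (deriv (deriv F)) (Ioo (-η₀) η₀) := hF1.deriv_of_isOpen isOpen_Ioo le_rfl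
  have hF3 : ContDiffOn ℝ ∞ (deriv (deriv (deriv F))) (Ioo (-η₀) η₀) :=
    hF2.deriv_of_isOpen isOpen_Ioo le_rfl
  have hF4 : ContDiffOn ℝ ∞ (deriv (deriv (deriv (deriv F)))) (Ioo (-η₀) η₀) :=
    hF3.deriv_of_isOpen isOpen_Ioo le_rfl
  have hF5 : ContDiffOn ℝ ∞ (deriv (deriv (deriv (deriv (deriv F))))) (Ioo (-η₀) η₀) :=
    hF4.deriv_of_isOpen isOpen_Ioo le_rfl
  have hsub : Icc 0 (η₀ / 2) ⊆ Ioo (-η₀) η₀ := fun η hη => ⟨by linarith [hη.1], by linarith [hη.2]⟩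
  obtain ⟨M₃, hM₃, hB₃⟩ := exists_abs_le_of_continuousOn_Icc (hF3.continuousOn.mono hsub)
  obtain ⟨M₄, hM₄, hB₄⟩ := exists_abs_le_of_continuousOn_Icc (hF4.continuousOn.mono hsub)
  obtain ⟨M₅, hM₅, hB₅⟩ := exists_abs_le_of_continuousOn_Icc (hF5.continuousOn.mono hsub)
  refine ⟨η₀ / 2, (η₀ / 2) ^ 2 * (3 * M₃ + η₀ / 2 * M₄) + (η₀ / 2) ^ 3 * (4 * M₄ + η₀ / 2 * M₅),
    by positivity, by linarith, by positivity, ?_⟩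
  intro σ hσ r hr hrη
  have hσ3 : 0 < σ ^ 3 := pow_pos hσ 3
  have hc : σ ^ 3 ≠ 0 := hσ3.ne'
  set η : ℝ := r * σ ^ 3 with hηdef
  have hη0 : 0 ≤ η := mul_nonneg hr hσ3.le
  have hηmem : η ∈ Icc 0 (η₀ / 2) := ⟨hη0, hrη⟩
  have hηI : η ∈ Ioo (-η₀) η₀ := hsub hηmem
  -- the rescaled law is the dilation of `Zf` by `σ³`
  set Zf : ℝ → ℝ := fun η => 1 + η * deriv F η with hZf
  have hζ : (fun r => 1 + r * σ ^ 3 * deriv F (r * σ ^ 3)) = fun τ => Zf (σ ^ 3 * τ) := by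
    funext τ; simp only [hZf]; rw [mul_comm (σ ^ 3) τ]
  have hdil : ∀ l : ℕ, iteratedDeriv l (fun r => 1 + r * σ ^ 3 * deriv F (r * σ ^ 3)) r =
      (σ ^ 3) ^ l * iteratedDeriv l Zf η := by
    intro l
    rw [hζ, Literature.Analysis.FluidPDE.iteratedDeriv_comp_mul_left_of_ne_zero Zf hc l r, smul_eq_mul,
      hηdef, mul_comm r]
  have hi3 : deriv (deriv (deriv (fun r => 1 + r * σ ^ 3 * deriv F (r * σ ^ 3)))) r =
      (σ ^ 3) ^ 3 * deriv (deriv (deriv Zf)) η := by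
    have := hdil 3
    rw [iteratedDeriv_eq_iterate, iteratedDeriv_eq_iterate] at this
    exact this
  have hi4 : deriv (deriv (deriv (deriv (fun r => 1 + r * σ ^ 3 * deriv F (r * σ ^ 3))))) r =
      (σ ^ 3) ^ 4 * deriv (deriv (deriv (deriv Zf))) η := by
    have := hdil 4
    rw [iteratedDeriv_eq_iterate, iteratedDeriv_eq_iterate] at this
    exact this
  obtain ⟨hZ3, hZ4⟩ := deriv_iter_one_add_mul_deriv hFc η hηI
  have b3 := hB₃ η hηmem
  have b4 := hB₄ η hηmem
  have b5 := hB₅ η hηmem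
  have hηle : η ≤ η₀ / 2 := hηmem.2
  have hη2 : η ^ 2 ≤ (η₀ / 2) ^ 2 := pow_le_pow_left₀ hη0 hηle 2
  have hη3' : η ^ 3 ≤ (η₀ / 2) ^ 3 := pow_le_pow_left₀ hη0 hηle 3
  refine ⟨?_, ?_⟩
  · rw [hi3, hZ3]
    have : r ^ 3 * ((σ ^ 3) ^ 3 * (3 * deriv (deriv (deriv F)) η + η * deriv (deriv (deriv (deriv F))) η)) =
        η * (η ^ 2 * (3 * deriv (deriv (deriv F)) η + η * deriv (deriv (deriv (deriv F))) η)) := by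
      rw [hηdef]; ring
    rw [this, abs_mul, abs_of_nonneg hη0]
    have hin : |η ^ 2 * (3 * deriv (deriv (deriv F)) η + η * deriv (deriv (deriv (deriv F))) η)| ≤
        (η₀ / 2) ^ 2 * (3 * M₃ + η₀ / 2 * M₄) := by
      rw [abs_mul, abs_of_nonneg (sq_nonneg η)]
      have h' : |3 * deriv (deriv (deriv F)) η + η * deriv (deriv (deriv (deriv F))) η| ≤ 3 * M₃ + η₀ / 2 * M₄ := by
        calc |3 * deriv (deriv (deriv F)) η + η * deriv (deriv (deriv (deriv F))) η|
            ≤ |3 * deriv (deriv (deriv F)) η| + |η * deriv (deriv (deriv (deriv F))) η| := abs_add_le _ _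
          _ = 3 * |deriv (deriv (deriv F)) η| + η * |deriv (deriv (deriv (deriv F))) η| := by
              rw [abs_mul (3 : ℝ), abs_mul η, abs_of_nonneg (by norm_num : (0:ℝ) ≤ 3), abs_of_nonneg hη0]
          _ ≤ 3 * M₃ + η₀ / 2 * M₄ :=
              add_le_add (mul_le_mul_of_nonneg_left b3 (by norm_num))
                (mul_le_mul hηle b4 (abs_nonneg _) (by linarith))
      exact mul_le_mul hη2 h' (abs_nonneg _) (sq_nonneg _)
    calc η * |η ^ 2 * (3 * deriv (deriv (deriv F)) η + η * deriv (deriv (deriv (deriv F))) η)|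
        ≤ η * ((η₀ / 2) ^ 2 * (3 * M₃ + η₀ / 2 * M₄)) := mul_le_mul_of_nonneg_left hin hη0
      _ ≤ ((η₀ / 2) ^ 2 * (3 * M₃ + η₀ / 2 * M₄) + (η₀ / 2) ^ 3 * (4 * M₄ + η₀ / 2 * M₅)) * η := by
          nlinarith [mul_nonneg (pow_nonneg (by positivity : (0:ℝ) ≤ η₀ / 2) 3)
            (by positivity : (0:ℝ) ≤ 4 * M₄ + η₀ / 2 * M₅)]
  · rw [hi4, hZ4]
    have : r ^ 4 * ((σ ^ 3) ^ 4 *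
        (4 * deriv (deriv (deriv (deriv F))) η + η * deriv (deriv (deriv (deriv (deriv F)))) η)) =
        η * (η ^ 3 * (4 * deriv (deriv (deriv (deriv F))) η +
          η * deriv (deriv (deriv (deriv (deriv F)))) η)) := by
      rw [hηdef]; ring
    rw [this, abs_mul, abs_of_nonneg hη0]
    have hin : |η ^ 3 * (4 * deriv (deriv (deriv (deriv F))) η +
        η * deriv (deriv (deriv (deriv (deriv F)))) η)| ≤ (η₀ / 2) ^ 3 * (4 * M₄ + η₀ / 2 * M₅) := by
      rw [abs_mul, abs_of_nonneg (pow_nonneg hη0 3)]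
      have h' : |4 * deriv (deriv (deriv (deriv F))) η + η * deriv (deriv (deriv (deriv (deriv F)))) η| ≤
          4 * M₄ + η₀ / 2 * M₅ := by
        calc |4 * deriv (deriv (deriv (deriv F))) η + η * deriv (deriv (deriv (deriv (deriv F)))) η|
            ≤ |4 * deriv (deriv (deriv (deriv F))) η| + |η * deriv (deriv (deriv (deriv (deriv F)))) η| :=
              abs_add_le _ _
          _ = 4 * |deriv (deriv (deriv (deriv F))) η| + η * |deriv (deriv (deriv (deriv (deriv F)))) η| := by
              rw [abs_mul (4 : ℝ), abs_mul η, abs_of_nonneg (by norm_num : (0:ℝ) ≤ 4), abs_of_nonneg hη0]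
          _ ≤ 4 * M₄ + η₀ / 2 * M₅ :=
              add_le_add (mul_le_mul_of_nonneg_left b4 (by norm_num))
                (mul_le_mul hηle b5 (abs_nonneg _) (by linarith))
      exact mul_le_mul hη3' h' (abs_nonneg _) (pow_nonneg (by positivity) 3)
    calc η * |η ^ 3 * (4 * deriv (deriv (deriv (deriv F))) η + η * deriv (deriv (deriv (deriv (deriv F)))) η)|
        ≤ η * ((η₀ / 2) ^ 3 * (4 * M₄ + η₀ / 2 * M₅)) := mul_le_mul_of_nonneg_left hin hη0
      _ ≤ ((η₀ / 2) ^ 2 * (3 * M₃ + η₀ / 2 * M₄) + (η₀ / 2) ^ 3 * (4 * M₄ + η₀ / 2 * M₅)) * η := by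
          nlinarith [mul_nonneg (sq_nonneg (η₀ / 2)) (by positivity : (0:ℝ) ≤ 3 * M₃ + η₀ / 2 * M₄)]

end Summit.AtomisticToContinuum.HydrodynamicLimit.Theorems

end
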